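import Summits.Ventures.CertifiedArithmetic.LowPrec.DoubleRoundingFMAWindowA

/-!
# Window B is never innocuous — the FMA through a wider format (THEOREM N-fma-B, all records)

HONEST FRAMING: certified error envelopes and provably optimal rounding/accumulation schemes for
low-precision formats under stated cost models; every table by two implementations; no hardware
or vendor claims.

`DFma φ ψ` (`DoubleRoundingFMAMatrix.lean`): ONE fused multiply-add of `φ`-data executed in the
wide format `ψ` and converted to `φ` is the correctly rounded FMA of `φ`.  THEOREM D-fma
(`dFma_of_windows`) proves it from the WINDOW CLAUSE (F): `P_ψ ≥ 2P_φ`, the grids nested,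
WINDOW A empty (`M_φ < 2^P_ψ`, whose converse is `DoubleRoundingFMAWindowA.lean`), and WINDOW B
empty or moot — `P_ψ ≥ 3P_φ`, or `maxRat φ < 2^(P_ψ + 2 L_φ)`: no PRODUCT of two data of `φ` is an
odd multiple of a power of two so long (`> P_ψ` bits) that, added to a datum of `φ`, it lands
strictly inside half an ulp of `ψ` of a midpoint of `φ`.  This file proves a CONVERSE OF THE
WINDOW-B CONJUNCT for EVERY pair of format records `φ ⊆ ψ` (`quantum ψ ∣ quantum φ` (`hq`), the
finite range of `φ` inside that of `ψ` (`hM`), `m_φ ≥ 1`, `bias φ ≥ 1`):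

* `not_dFma_of_windowB` — if `m_φ < m_ψ < m_φ + 2h` for some `h ≤ m_φ` and the three data below
  are in range, then `¬ DFma φ ψ` (STRICT column: every `P_φ < P_ψ ≤ 3P_φ - 2`);
* `not_dFma_of_windowB_tie` — if `m_ψ = m_φ + 2h`, `1 ≤ h ≤ m_φ` (TIE column, `P_ψ - P_φ` even,
  up to `P_ψ = 3P_φ - 2`; the tie of `ψ` resolves onto the midpoint, [BoldoMelquiond2008] Thm 3);
* `not_dFma_windowB` — both columns as ONE decidable hypothesis in the two parameters `h`
  (half the width of the product) and `k` (its binade); `not_dFma_windowB_canon` — the same with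
  the canonical `h = ⌊(m_ψ - m_φ)/2⌋ + 1` (strict) / `(m_ψ - m_φ)/2` (tie) and the least binade,
  which holds on exactly `19` of the `169` named cells (`dFmaWindowB_named_iff`), all failing
  cells of `dFma_named_iff` (`dFmaWindowB_cells`) — the whole e2m1 row (`8` cells, formerly "one
  searched witness each"), e3m2 → e4m3 / binary8p4 / binary8p4f, e2m3 → binary8p5 / bfloat16,
  e4m3 / binary8p4 / binary8p4f / binary8p5 → bfloat16, binary8p5 → binary16, binary16 → binary32;
* `dFma_named_failing_laws` — CLASSIFICATION of the named matrix: every failing cell `X ⊆ Y` of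
  `dFma_named_iff` is an instance of THEOREM N-fma-A (`22` cells), of THEOREM N-fma-B (`19`, `11`
  of them not window-A cells), or has `P_X = P_Y` (`7` cells: e3m2 → e5m2 / binary8p3 /
  binary8p3f, e2m3 → e4m3 / binary8p4 / binary8p4f, e5m2 → binary8p3f — slips at the subnormal
  midpoints of `X`, not decided here).

THE WITNESS (`exists_windowB_data`), for `2h + j + 1 = k + m + bias` (so that
`2^(2h+j) · quantum φ = 2^k`):  `a = -(2^h - 1)·2^j`, `b = 2^h + 1` quanta — the product
`-(4^h - 1)·2^j · quantum² = -2^k · quantum + δ`, `δ = 2^j · quantum²` — and `c = (2^m + 1)·2^(k+1)`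
quanta, the ODD neighbour above the midpoint `μ = (2·2^m + 1)·2^k` quanta of `φ` (whose even
neighbour is `2^(m+k+1)` quanta): `a·b + c = μ + δ`.  The spacing of `ψ` at `μ` is
`2^(m + k + D + 1 - m_ψ) · quantum ψ` (`D = L_φ - L_ψ`), and `2δ <` it iff `m_ψ < m + 2h`: then
`fl_ψ(a·b + c) = μ`, `fl_φ μ = 2^(m+k+1)` quanta (tie to even) while `fl_φ(a·b + c) = c`
(`DoubleRoundingProductStrip.roundNE_roundNE_ne_gmid`); `2δ =` it iff `m_ψ = m + 2h`, and then
`a·b + c` is a tie of `ψ` whose even side is `μ`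
(`DoubleRoundingGmidBelow.roundNE_roundNE_ne_gmid_tie`).  The range needed is
`c = (2^m + 1)·2^(k+1) ≤ maxScaled φ` at the least binade `k = (2h+1) ∸ (m+bias)` (given
`bias φ ≤ bias ψ`; in general also `k ≥ m_ψ - m - D`).  Clause (F) finds window B moot
below `2^(m_ψ+2-m-bias)` quanta; when `2h + 1 ≥ m + bias`, `c` is `2(1 + 2^-m)` times that
threshold on the columns with `m_ψ - m` odd and `(1 + 2^-m)` times it on the tie column (else
`c = 2(2^m + 1)`): record-generically the window-B conjunct of (F) is necessary up to that factor
on every column `P_φ < P_ψ ≤ 3P_φ - 2`.  NOT DECIDED here: ranges between the threshold and `c`,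
and the last column `P_ψ = 3P_φ - 1` of window B — there the same mechanism wants a product of two
`P_φ`-bit significands one unit off `2^(2m+1)`, which is a number-theoretic accident (`3·3 = 2^3+1`,
`19·27 = 2^9+1`, `151·217 = 2^15-1` for `P_φ = 2, 5, 8`; none for `P_φ = 3, 4`); among the named
cells of that column e2m1 → binary8p5 and e2m3 → binary16 are innocuous by (F) and
e4m3 → binary16 fails by window A.  PLACEMENT: double roundings are innocuous for `+ - × ÷ √`
once `P_ψ ≥ 2P_φ + 2` [Figueroa1995] §3, [Roux2014] §2; for the FMA [BoldoMelquiond2008] §4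
emulates with round-to-odd instead, and (F) / this file quantify the range at which nearest-even
emulation breaks: with `P_φ < P_ψ ≤ 3P_φ - 2` a single FMA in `ψ` is never a correctly rounded FMA
of `φ` once `maxScaled φ ≥ (2^m + 1)·2^(k+1)`.  Slips forced onto midpoints:
[MartinDorelMelquiondMuller2013] Property 2.1.  We found no statement of this law in the
literature searched (queries in the cell's notes).
Implementation A: `code/enum/fma_windowB_law.py` → `DOUBLE-ROUNDING-FMA.md` §8,
`certs/enum/DOUBLE-ROUNDING-FMA-WINDOWB.json`.  No hardware or vendor claims.
-/

namespace Summit.Ventures.CertifiedArithmetic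

open Literature.ComputerArithmetic.FloatingPoint
open Literature.ComputerArithmetic.FloatingPoint.Format
open Literature.ComputerArithmetic.FloatingPoint.MiniFloat

/-! ## §1 The witness data -/

/-- THE WINDOW-B DATA of a record `φ` with `m ≥ 1`, `bias ≥ 1`: for `h ≤ m` and
`2h + (i₁ + i₂) + 1 = k + m + bias`, the data `a = -(2^h - 1)·2^i₁`, `b = (2^h + 1)·2^i₂`,
`c = (2^m + 1)·2^(k+1)` quanta (each in range) have
`a·b + c = (2·2^m + 1)·2^k · quantum + 2^(i₁+i₂) · quantum²`. [this packet] -/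
theorem exists_windowB_data {φ : Format} (h1 : 1 ≤ φ.manBits) (hb : 1 ≤ φ.bias)
    {h i₁ i₂ k : ℕ} (hh : h ≤ φ.manBits) (hk : 2 * h + (i₁ + i₂) + 1 = k + (φ.manBits + φ.bias))
    (hu : (2 ^ φ.manBits + 1) * 2 ^ (k + 1) ≤ φ.maxScaled)
    (ha : (2 ^ h - 1) * 2 ^ i₁ ≤ φ.maxScaled) (hb' : (2 ^ h + 1) * 2 ^ i₂ ≤ φ.maxScaled) :
    ∃ a b c : MiniFloat φ, a.toRat * b.toRat + c.toRat =
      (((2 * 2 ^ φ.manBits + 1) * 2 ^ k : ℕ) : ℚ) * φ.quantum +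
        2 ^ (i₁ + i₂) * φ.quantum * φ.quantum := by
  obtain ⟨e, he⟩ : ∃ e, φ.manBits + φ.bias = e + 1 := ⟨φ.manBits + (φ.bias - 1), by omega⟩
  have hunit : (2 : ℚ) ^ e * φ.quantum = 1 := by
    have hu1 := two_pow_mul_quantum_eq_one hb
    rwa [show φ.manBits + (φ.bias - 1) = e by omega] at hu1
  have hpow : (2 : ℚ) ^ h * 2 ^ h * 2 ^ i₁ * 2 ^ i₂ = 2 ^ k * 2 ^ e := by
    rw [← pow_add, ← pow_add, ← pow_add, ← pow_add]
    congr 1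
    omega
  -- the data
  have hhm : 2 ^ h ≤ 2 ^ φ.manBits := Nat.pow_le_pow_right (by norm_num) hh
  have h2m : 2 ≤ 2 ^ φ.manBits := by
    calc (2 : ℕ) = 2 ^ 1 := by norm_num
      _ ≤ 2 ^ φ.manBits := Nat.pow_le_pow_right (by norm_num) h1
  have hm1 : 2 ^ (φ.manBits + 1) = 2 * 2 ^ φ.manBits := by rw [pow_succ]; ring
  have halt : 2 ^ h - 1 < 2 ^ (φ.manBits + 1) := by rw [hm1]; omega
  obtain ⟨a, ha2⟩ := exists_toRat_eq_natMul (representable_mul_pow halt ha)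
  have hblt : 2 ^ h + 1 < 2 ^ (φ.manBits + 1) := by rw [hm1]; omega
  obtain ⟨b, hb2⟩ := exists_toRat_eq_natMul (representable_mul_pow hblt hb')
  have hclt : 2 ^ φ.manBits + 1 < 2 ^ (φ.manBits + 1) := by rw [hm1]; omega
  obtain ⟨c, hc⟩ := exists_toRat_eq_natMul (representable_mul_pow hclt hu)
  refine ⟨a.flipSign, b, c, ?_⟩
  rw [toRat_flipSign, ha2, hb2, hc]
  push_cast [Nat.cast_sub (Nat.one_le_two_pow (n := h))]
  linear_combination (-(φ.quantum * φ.quantum)) * hpow + (-(2 ^ k * φ.quantum)) * hunit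

/-! ## §2 The window-B law -/

/-- THEOREM N-fma-B (strict column).  For records `φ ⊆ ψ` (`hq`, `hM`) with `m_φ ≥ 1`,
`bias φ ≥ 1`, `h ≤ m_φ`, `m_φ < m_ψ < m_φ + 2h`, `2h + (i₁ + i₂) + 1 = k + m_φ + bias φ`,
`m_ψ ≤ m_φ + k + D` and the data of `exists_windowB_data` in range: `¬ DFma φ ψ` — the datum
`a·b + c` lies `δ = 2^(i₁+i₂)·quantum²` above the midpoint `(2·2^m + 1)·2^k` quanta, and
`2δ < 2^(m + k + D + 1 - m_ψ)·quantum ψ`, the spacing of `ψ` there. [this packet] -/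
theorem not_dFma_of_windowB {φ ψ : Format} (hq : ψ.qexp ≤ φ.qexp)
    (hM : φ.maxScaled * 2 ^ (φ.qexp - ψ.qexp).toNat ≤ ψ.maxScaled) (h1 : 1 ≤ φ.manBits)
    (hb : 1 ≤ φ.bias) {h i₁ i₂ k : ℕ} (hh : h ≤ φ.manBits) (hP : φ.manBits < ψ.manBits)
    (hB : ψ.manBits < φ.manBits + 2 * h)
    (hk : 2 * h + (i₁ + i₂) + 1 = k + (φ.manBits + φ.bias))
    (hk' : ψ.manBits ≤ φ.manBits + k + (φ.qexp - ψ.qexp).toNat)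
    (hu : (2 ^ φ.manBits + 1) * 2 ^ (k + 1) ≤ φ.maxScaled)
    (ha : (2 ^ h - 1) * 2 ^ i₁ ≤ φ.maxScaled) (hb' : (2 ^ h + 1) * 2 ^ i₂ ≤ φ.maxScaled) :
    ¬ DFma φ ψ := by
  obtain ⟨a, b, c, habc⟩ := exists_windowB_data h1 hb hh hk hu ha hb'
  set d := (φ.qexp - ψ.qexp).toNat with hd
  have hqφ := φ.quantum_pos
  have hqψ := ψ.quantum_pos
  have hquant : φ.quantum = 2 ^ d * ψ.quantum := quantum_eq_two_pow_mul hq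
  have hkey : (2 : ℚ) ^ (2 * h + (i₁ + i₂)) * φ.quantum = 2 ^ k := by
    rw [show 2 * h + (i₁ + i₂) = k + (φ.manBits + (φ.bias - 1)) by omega, pow_add, mul_assoc,
      two_pow_mul_quantum_eq_one hb, mul_one]
  have hδ0 : (0 : ℚ) < 2 ^ (i₁ + i₂) * φ.quantum * φ.quantum := by positivity
  have hδψ : 2 * (2 ^ (i₁ + i₂) * φ.quantum * φ.quantum)
      < 2 ^ (φ.manBits + k + d + 1 - ψ.manBits) * ψ.quantum := by
    have H : (2 : ℚ) ^ (2 * h) * (2 * (2 ^ (i₁ + i₂) * φ.quantum * φ.quantum))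
        < 2 ^ (2 * h) * (2 ^ (φ.manBits + k + d + 1 - ψ.manBits) * ψ.quantum) := by
      calc (2 : ℚ) ^ (2 * h) * (2 * (2 ^ (i₁ + i₂) * φ.quantum * φ.quantum))
          = 2 * (2 ^ (2 * h + (i₁ + i₂)) * φ.quantum) * φ.quantum := by rw [pow_add]; ring
        _ = 2 ^ (k + d + 1) * ψ.quantum := by rw [hkey, hquant, pow_add, pow_succ]; ring
        _ < 2 ^ (2 * h + (φ.manBits + k + d + 1 - ψ.manBits)) * ψ.quantum :=
          mul_lt_mul_of_pos_right (pow_lt_pow_right₀ (by norm_num) (by omega)) hqψ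
        _ = 2 ^ (2 * h) * (2 ^ (φ.manBits + k + d + 1 - ψ.manBits) * ψ.quantum) := by
          rw [pow_add]; ring
    exact lt_of_mul_lt_mul_left H (by positivity)
  have ht : Even (2 ^ φ.manBits) := Nat.even_pow.mpr ⟨even_two, by omega⟩
  have hthi : 2 ^ φ.manBits < 2 ^ (φ.manBits + 1) := Nat.pow_lt_pow_right (by norm_num) (by omega)
  intro hD
  have h' := hD a b c
  rw [habc] at h'
  exact roundNE_roundNE_ne_gmid hq hM h1 hP ht le_rfl hthi hu hk' hδ0 hδψ h'

/-- THEOREM N-fma-B (tie column).  For records `φ ⊆ ψ` with `m_φ ≥ 1`, `bias φ ≥ 1`,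
`1 ≤ h ≤ m_φ`, `m_ψ = m_φ + 2h`, `2h + (i₁ + i₂) + 1 = k + m_φ + bias φ`, `m_ψ ≤ m_φ + k + D` and
the data in range: `¬ DFma φ ψ` — now `2δ` is exactly the spacing of `ψ` at the midpoint, which
is the even candidate of the tie. [cite: BoldoMelquiond2008, Thm 3] -/
theorem not_dFma_of_windowB_tie {φ ψ : Format} (hq : ψ.qexp ≤ φ.qexp)
    (hM : φ.maxScaled * 2 ^ (φ.qexp - ψ.qexp).toNat ≤ ψ.maxScaled) (h1 : 1 ≤ φ.manBits)
    (hb : 1 ≤ φ.bias) {h i₁ i₂ k : ℕ} (hh : h ≤ φ.manBits) (h0 : 1 ≤ h)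
    (hB : ψ.manBits = φ.manBits + 2 * h)
    (hk : 2 * h + (i₁ + i₂) + 1 = k + (φ.manBits + φ.bias))
    (hk' : ψ.manBits ≤ φ.manBits + k + (φ.qexp - ψ.qexp).toNat)
    (hu : (2 ^ φ.manBits + 1) * 2 ^ (k + 1) ≤ φ.maxScaled)
    (ha : (2 ^ h - 1) * 2 ^ i₁ ≤ φ.maxScaled) (hb' : (2 ^ h + 1) * 2 ^ i₂ ≤ φ.maxScaled) :
    ¬ DFma φ ψ := by
  obtain ⟨a, b, c, habc⟩ := exists_windowB_data h1 hb hh hk hu ha hb'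
  set d := (φ.qexp - ψ.qexp).toNat with hd
  have hqφ := φ.quantum_pos
  have hqψ := ψ.quantum_pos
  have hquant : φ.quantum = 2 ^ d * ψ.quantum := quantum_eq_two_pow_mul hq
  have hkey : (2 : ℚ) ^ (2 * h + (i₁ + i₂)) * φ.quantum = 2 ^ k := by
    rw [show 2 * h + (i₁ + i₂) = k + (φ.manBits + (φ.bias - 1)) by omega, pow_add, mul_assoc,
      two_pow_mul_quantum_eq_one hb, mul_one]
  have hδψ : 2 * (2 ^ (i₁ + i₂) * φ.quantum * φ.quantum)
      = 2 ^ (φ.manBits + k + d + 1 - ψ.manBits) * ψ.quantum := by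
    have H : (2 : ℚ) ^ (2 * h) * (2 * (2 ^ (i₁ + i₂) * φ.quantum * φ.quantum))
        = 2 ^ (2 * h) * (2 ^ (φ.manBits + k + d + 1 - ψ.manBits) * ψ.quantum) := by
      calc (2 : ℚ) ^ (2 * h) * (2 * (2 ^ (i₁ + i₂) * φ.quantum * φ.quantum))
          = 2 * (2 ^ (2 * h + (i₁ + i₂)) * φ.quantum) * φ.quantum := by rw [pow_add]; ring
        _ = 2 ^ (k + d + 1) * ψ.quantum := by rw [hkey, hquant, pow_add, pow_succ]; ring
        _ = 2 ^ (2 * h + (φ.manBits + k + d + 1 - ψ.manBits)) * ψ.quantum := by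
          rw [show 2 * h + (φ.manBits + k + d + 1 - ψ.manBits) = k + d + 1 by omega]
        _ = 2 ^ (2 * h) * (2 ^ (φ.manBits + k + d + 1 - ψ.manBits) * ψ.quantum) := by
          rw [pow_add]; ring
    exact mul_left_cancel₀ (by positivity) H
  have ht : Even (2 ^ φ.manBits) := Nat.even_pow.mpr ⟨even_two, by omega⟩
  have hthi : 2 ^ φ.manBits < 2 ^ (φ.manBits + 1) := Nat.pow_lt_pow_right (by norm_num) (by omega)
  intro hD
  have h' := hD a b c
  rw [habc] at h'
  exact roundNE_roundNE_ne_gmid_tie hq hM h1 (by omega) ht le_rfl hthi hu hk' hδψ h'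

/-- THEOREM N-fma-B, both columns as ONE hypothesis on parameter records, in the two parameters
`h` (the product is `-(4^h - 1)·2^j` quanta², `j = k + m + bias - 2h - 1`, of the data
`-(2^h - 1)·2^j` and `2^h + 1` quanta) and `k` (the binade of the midpoint `(2·2^m + 1)·2^k`):
grids and ranges nested, `1 ≤ m_φ`, `1 ≤ bias φ`, `h ≤ m_φ`, `m_φ < m_ψ ≤ m_φ + 2h`,
`2h + 1 ≤ k + m_φ + bias φ`, `m_ψ ≤ m_φ + k + D`, and the addend `(2^m + 1)·2^(k+1)` and the factor
`(2^h - 1)·2^j` in range.  (A decidable conjunction: on records and numerals `h`, `k` it is ONE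
`decide`.) [this packet] -/
theorem not_dFma_windowB {φ ψ : Format} (h k : ℕ)
    (H : ψ.qexp ≤ φ.qexp ∧ φ.maxScaled * 2 ^ (φ.qexp - ψ.qexp).toNat ≤ ψ.maxScaled ∧
      1 ≤ φ.manBits ∧ 1 ≤ φ.bias ∧ h ≤ φ.manBits ∧ φ.manBits < ψ.manBits ∧
      ψ.manBits ≤ φ.manBits + 2 * h ∧ 2 * h + 1 ≤ k + (φ.manBits + φ.bias) ∧
      ψ.manBits ≤ φ.manBits + k + (φ.qexp - ψ.qexp).toNat ∧
      (2 ^ φ.manBits + 1) * 2 ^ (k + 1) ≤ φ.maxScaled ∧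
      (2 ^ h - 1) * 2 ^ (k + (φ.manBits + φ.bias) - (2 * h + 1)) ≤ φ.maxScaled) : ¬ DFma φ ψ := by
  obtain ⟨hq, hM, h1, hb, hh, hP, hB, hk, hk', hu, ha⟩ := H
  have hb' : (2 ^ h + 1) * 2 ^ 0 ≤ φ.maxScaled := by
    have hhm : 2 ^ h ≤ 2 ^ φ.manBits := Nat.pow_le_pow_right (by norm_num) hh
    calc (2 ^ h + 1) * 2 ^ 0 = 2 ^ h + 1 := by rw [pow_zero, mul_one]
      _ ≤ 2 ^ φ.manBits + 1 := by omega
      _ ≤ (2 ^ φ.manBits + 1) * 2 ^ (k + 1) := Nat.le_mul_of_pos_right _ (by positivity)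
      _ ≤ φ.maxScaled := hu
  have hkj : 2 * h + (k + (φ.manBits + φ.bias) - (2 * h + 1) + 0) + 1 =
      k + (φ.manBits + φ.bias) := by omega
  rcases Nat.lt_or_ge ψ.manBits (φ.manBits + 2 * h) with hlt | hge
  · exact not_dFma_of_windowB hq hM h1 hb hh hP hlt hkj hk' hu ha hb'
  · exact not_dFma_of_windowB_tie hq hM h1 hb hh (by omega) (by omega) hkj hk' hu ha hb'

/-- THEOREM N-fma-B WITH THE CANONICAL PARAMETERS: `h = ⌊(m_ψ - m_φ)/2⌋ + 1` (strict column) or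
`h = (m_ψ - m_φ)/2` (tie column, `m_ψ - m_φ` even), the least binade `k = (2h + 1) ∸ (m_φ + bias φ)`
and `j = (m_φ + bias φ) ∸ (2h + 1)`; with `bias φ ≤ bias ψ` the grid condition `m_ψ ≤ m_φ + k + D`
is automatic.  One closed decidable test on parameter records (implementation A evaluates the
same test). [this packet] -/
theorem not_dFma_windowB_canon {φ ψ : Format}
    (H : ψ.qexp ≤ φ.qexp ∧ φ.maxScaled * 2 ^ (φ.qexp - ψ.qexp).toNat ≤ ψ.maxScaled ∧
      1 ≤ φ.manBits ∧ 1 ≤ φ.bias ∧ φ.bias ≤ ψ.bias ∧ φ.manBits < ψ.manBits ∧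
      ((ψ.manBits - φ.manBits) / 2 + 1 ≤ φ.manBits ∧
        (2 ^ φ.manBits + 1) *
            2 ^ (2 * ((ψ.manBits - φ.manBits) / 2) + 3 - (φ.manBits + φ.bias) + 1) ≤ φ.maxScaled ∧
        (2 ^ ((ψ.manBits - φ.manBits) / 2 + 1) - 1) *
            2 ^ (φ.manBits + φ.bias - (2 * ((ψ.manBits - φ.manBits) / 2) + 3)) ≤ φ.maxScaled ∨
       (ψ.manBits - φ.manBits) % 2 = 0 ∧ (ψ.manBits - φ.manBits) / 2 ≤ φ.manBits ∧
        (2 ^ φ.manBits + 1) *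
            2 ^ (ψ.manBits - φ.manBits + 1 - (φ.manBits + φ.bias) + 1) ≤ φ.maxScaled ∧
        (2 ^ ((ψ.manBits - φ.manBits) / 2) - 1) *
            2 ^ (φ.manBits + φ.bias - (ψ.manBits - φ.manBits + 1)) ≤ φ.maxScaled)) :
    ¬ DFma φ ψ := by
  obtain ⟨hq, hM, h1, hb, hbb, hP, hcol⟩ := H
  have hD := manBits_add_bias_add_toNat hq
  rcases hcol with ⟨hh, hu, ha⟩ | ⟨hev, hh, hu, ha⟩
  · refine not_dFma_windowB ((ψ.manBits - φ.manBits) / 2 + 1)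
      (2 * ((ψ.manBits - φ.manBits) / 2) + 3 - (φ.manBits + φ.bias))
      ⟨hq, hM, h1, hb, hh, hP, by omega, by omega, by omega, hu, ?_⟩
    rwa [show 2 * ((ψ.manBits - φ.manBits) / 2) + 3 - (φ.manBits + φ.bias) +
        (φ.manBits + φ.bias) - (2 * ((ψ.manBits - φ.manBits) / 2 + 1) + 1) =
        φ.manBits + φ.bias - (2 * ((ψ.manBits - φ.manBits) / 2) + 3) by omega]
  · refine not_dFma_windowB ((ψ.manBits - φ.manBits) / 2)
      (ψ.manBits - φ.manBits + 1 - (φ.manBits + φ.bias))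
      ⟨hq, hM, h1, hb, hh, hP, by omega, by omega, by omega, hu, ?_⟩
    rwa [show ψ.manBits - φ.manBits + 1 - (φ.manBits + φ.bias) + (φ.manBits + φ.bias) -
        (2 * ((ψ.manBits - φ.manBits) / 2) + 1) =
        φ.manBits + φ.bias - (ψ.manBits - φ.manBits + 1) by omega]

/-! ## §3 The named records -/

/-- ON THE NAMED `13 × 13` MATRIX the canonical window-B hypothesis holds on exactly these `19`
cells (`14` by the strict column, `9` by the tie column, `4` by both).  The whole e2m1 row of
failing cells (`a·b + c = -1/2 · 3/2 + 6 = 21/4`, `h = k = 1`), the three "product finer than the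
quantum" cells of `dFmaWindowA_named_iff`'s complement (e2m3 → binary8p5 / bfloat16,
binary8p5 → binary16), and `8` cells that are also window-A cells.  Implementation A tabulates
the same `19`. [this packet] -/
theorem dFmaWindowB_named_iff : ∀ X ∈ namedFormats, ∀ Y ∈ namedFormats,
    (Y.qexp ≤ X.qexp ∧ X.maxScaled * 2 ^ (X.qexp - Y.qexp).toNat ≤ Y.maxScaled ∧
      1 ≤ X.manBits ∧ 1 ≤ X.bias ∧ X.bias ≤ Y.bias ∧ X.manBits < Y.manBits ∧
      ((Y.manBits - X.manBits) / 2 + 1 ≤ X.manBits ∧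
        (2 ^ X.manBits + 1) *
            2 ^ (2 * ((Y.manBits - X.manBits) / 2) + 3 - (X.manBits + X.bias) + 1) ≤ X.maxScaled ∧
        (2 ^ ((Y.manBits - X.manBits) / 2 + 1) - 1) *
            2 ^ (X.manBits + X.bias - (2 * ((Y.manBits - X.manBits) / 2) + 3)) ≤ X.maxScaled ∨
       (Y.manBits - X.manBits) % 2 = 0 ∧ (Y.manBits - X.manBits) / 2 ≤ X.manBits ∧
        (2 ^ X.manBits + 1) *
            2 ^ (Y.manBits - X.manBits + 1 - (X.manBits + X.bias) + 1) ≤ X.maxScaled ∧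
        (2 ^ ((Y.manBits - X.manBits) / 2) - 1) *
            2 ^ (X.manBits + X.bias - (Y.manBits - X.manBits + 1)) ≤ X.maxScaled)) ↔
    (X, Y) ∈ [(E2M1, E3M2), (E2M1, E2M3), (E2M1, E4M3), (E2M1, E5M2), (E2M1, Binary8p3),
      (E2M1, Binary8p4), (E2M1, Binary8p3F), (E2M1, Binary8p4F), (E3M2, E4M3), (E3M2, Binary8p4),
      (E3M2, Binary8p4F), (E2M3, Binary8p5), (E2M3, BFloat16), (E4M3, BFloat16),
      (Binary8p4, BFloat16), (Binary8p5, Binary16), (Binary8p5, BFloat16), (Binary8p4F, BFloat16),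
      (Binary16, Binary32)] := by
  decide +kernel

/-- THE `19` WINDOW-B CELLS FAIL BY THE LAW (and are failing cells of the matrix, `∉ dFmaPairs`):
the e2m1 row, e3m2 → e4m3 / binary8p4 / binary8p4f, e2m3 → binary8p5 / bfloat16, e4m3 /
binary8p4 / binary8p4f / binary8p5 → bfloat16, binary8p5 → binary16, binary16 → binary32 — each
an instance of one record-generic theorem rather than a searched witness. [this packet] -/
theorem dFmaWindowB_cells : ∀ p ∈ [(E2M1, E3M2), (E2M1, E2M3), (E2M1, E4M3), (E2M1, E5M2),
    (E2M1, Binary8p3), (E2M1, Binary8p4), (E2M1, Binary8p3F), (E2M1, Binary8p4F), (E3M2, E4M3),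
    (E3M2, Binary8p4), (E3M2, Binary8p4F), (E2M3, Binary8p5), (E2M3, BFloat16), (E4M3, BFloat16),
    (Binary8p4, BFloat16), (Binary8p5, Binary16), (Binary8p5, BFloat16), (Binary8p4F, BFloat16),
    (Binary16, Binary32)], p ∉ dFmaPairs ∧ ¬ DFma p.1 p.2 := by
  intro p hp
  simp only [List.mem_cons, List.not_mem_nil, or_false] at hp
  rcases hp with rfl | rfl | rfl | rfl | rfl | rfl | rfl | rfl | rfl | rfl | rfl | rfl | rfl |
    rfl | rfl | rfl | rfl | rfl | rfl
  all_goals exact ⟨by decide +kernel, not_dFma_windowB_canon (by decide +kernel)⟩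

/-- Through binary64: binary32 (`m_ψ = 52 ≤ 3·23`; strict column, `h = 15`, the product
`-(2^15 - 1)(2^15 + 1)·2^119` quanta²) is a window-B cell as well as a window-A cell
(`not_dFma_binary64_of_range`); bfloat16 and binary16 are not (`52 > 3m`). -/
example : ¬ DFma Binary32 Binary64 := not_dFma_windowB_canon (by decide +kernel)

/-! ## §4 Classification of the named matrix -/

/-- CLASSIFICATION.  Every failing cell `X ⊆ Y` (`embedsTest`, `∉ dFmaPairs`) of the named FMA
matrix `dFma_named_iff` has `P_X = P_Y` (`7` cells), or satisfies the hypothesis of THEOREM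
N-fma-A (`not_dFma_windowA`, `22` cells) or that of THEOREM N-fma-B (`not_dFma_windowB_canon`,
`19` cells, `8` of them also window-A cells): `33` of the `40` failing embedded cells are
instances of two record-generic laws.  (Non-embedded pairs fail by `embeds_of_dFma_named`.)
[this packet] -/
theorem dFma_named_failing_laws : ∀ X ∈ namedFormats, ∀ Y ∈ namedFormats,
    embedsTest X Y = true → (X, Y) ∉ dFmaPairs →
    X.manBits = Y.manBits ∨
    (Y.qexp ≤ X.qexp ∧ X.maxScaled * 2 ^ (X.qexp - Y.qexp).toNat ≤ Y.maxScaled ∧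
      2 ≤ X.manBits ∧ 1 ≤ X.bias ∧ 2 ^ (X.manBits + X.bias + 1) ≤ X.maxScaled ∧
      (X.manBits < Y.manBits ∧ 3 * 2 ^ (Y.manBits + 1) ≤ X.maxScaled ∨
        X.manBits + 2 ≤ Y.manBits ∧ 3 * 2 ^ Y.manBits ≤ X.maxScaled)) ∨
    (Y.qexp ≤ X.qexp ∧ X.maxScaled * 2 ^ (X.qexp - Y.qexp).toNat ≤ Y.maxScaled ∧
      1 ≤ X.manBits ∧ 1 ≤ X.bias ∧ X.bias ≤ Y.bias ∧ X.manBits < Y.manBits ∧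
      ((Y.manBits - X.manBits) / 2 + 1 ≤ X.manBits ∧
        (2 ^ X.manBits + 1) *
            2 ^ (2 * ((Y.manBits - X.manBits) / 2) + 3 - (X.manBits + X.bias) + 1) ≤ X.maxScaled ∧
        (2 ^ ((Y.manBits - X.manBits) / 2 + 1) - 1) *
            2 ^ (X.manBits + X.bias - (2 * ((Y.manBits - X.manBits) / 2) + 3)) ≤ X.maxScaled ∨
       (Y.manBits - X.manBits) % 2 = 0 ∧ (Y.manBits - X.manBits) / 2 ≤ X.manBits ∧
        (2 ^ X.manBits + 1) *
            2 ^ (Y.manBits - X.manBits + 1 - (X.manBits + X.bias) + 1) ≤ X.maxScaled ∧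
        (2 ^ ((Y.manBits - X.manBits) / 2) - 1) *
            2 ^ (X.manBits + X.bias - (Y.manBits - X.manBits + 1)) ≤ X.maxScaled)) := by
  decide +kernel

/-- The seven failing embedded cells outside both laws are exactly the equal-precision ones. -/
theorem dFma_named_failing_equal_precision : ∀ X ∈ namedFormats, ∀ Y ∈ namedFormats,
    embedsTest X Y = true → (X, Y) ∉ dFmaPairs → X.manBits = Y.manBits →
    (X, Y) ∈ [(E3M2, E5M2), (E3M2, Binary8p3), (E3M2, Binary8p3F), (E2M3, E4M3),
      (E2M3, Binary8p4), (E2M3, Binary8p4F), (E5M2, Binary8p3F)] := by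
  decide +kernel

end Summit.Ventures.CertifiedArithmetic
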